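import Summits.QuantumFields.YangMills.Theorems.BalabanUVNodesN18TransportOfRecordCovariance
import Literature.MathematicalPhysics.QuantumFieldTheory.Balaban1983to89.Node00.Record12BgRowAnalysis
import Mathlib.Analysis.CStarAlgebra.Spectrum
import HarnessLib

/-!
# BalabanUVNodes ∕ node N18 = NE5 — closure-ledger item (iii): THE PLAQUETTE BOX OF A REAL BACKGROUND READ INSIDE A SPACE `U^c_j(X, α₀, α₁)` OF RECORD,
# THROUGH AN ARBITRARY COMPLEX GAUGE, AND THE GUARD `hsm` OF THE TRANSPORT-CLAUSE KNIT FROM A PLAQUETTE COVER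
# (Track A, DAG node N18 = `T4OutputRate.NE5` :211; cluster K4 «SpineRates», item K3⁷ `SpineGivenEndpointR13SepCoPH`; seat pub-ymgap-dag-n18-w3 g3)

HONEST FRAMING.  Count-neutral kernel bookkeeping (`--supports stmt-QuantumFields-20544 --as helper`): one C⋆-algebra lemma (a star-normal element conjugate
to `b` by a unit has norm `≤ ‖b‖`: spectral radius) and its reading at the spaces of record, PROVED; the analysis input (T3) `hsat` stays displayed; nothing of
Bałaban's RG asserted; NE5 NOT PRINTED ∕ NOT proved; N18 NOT discharged; nothing about the continuum ∕ OS ∕ mass gap ∕ Clay.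

WHY.  `Thm/BalabanUVNodesN18TransportOfRecordCovariance` (this seat, FILE 1) instantiates module 21 v1.1 at W1-18's transports of record and leaves, besides the
analysis input `hsat` and the positivity of run A's radii, ONE structural hypothesis: the small-field GUARD of the (0.4) average on run B's admissible backgrounds
(`hsm`: every `SU(N)`-valued `U` whose reading `(ιU, 0)` lies in the space of record `U^c_j(Y, α₀(j), α₁(j))` at every `(j, Y)` has `δ_N`-small loop variables —
node00-def-W1's «remaining by name: `hsm` (space-membership ⇒ plaquette box ⇒ guard)», W1-18 docstring), with the edition `…_of_plaqBound` reducing it to a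
plaquette box `|U(∂q) − 1| < a`.  Membership of `(ιU, 0)` in `U^c_j` means `ιU = 𝐔₀^u` for SOME `Gᶜ = SL(N, ℂ)`-valued gauge `u` and a pair `(𝐔₀, 𝐉₀)` satisfying
(i)–(iv); (iii) = (1.14) gives `|∂𝐔₀(p) − 1| < α₀ξ²` on the plaquettes inside `Y`, and `∂(ιU)(p) = u(x)·∂𝐔₀(p)·u(x)⁻¹` (`plaq_gaugeU`).  Conjugation by a
NON-UNITARY `u(x)` does not preserve the operator norm — but `∂(ιU)(p)` is unitary, hence `∂(ιU)(p) − 1 = u(x)(∂𝐔₀(p) − 1)u(x)⁻¹` is STAR-NORMAL and similar to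
`∂𝐔₀(p) − 1`, so its norm IS its spectral radius, which is that of `∂𝐔₀(p) − 1`, which is at most `‖∂𝐔₀(p) − 1‖ < α₀ξ²`.  So the real background inherits the
plaquette box of (1.14) VERBATIM, whatever the complex gauge — and the guard follows by [Balaban1985Averaging] Prop. 1 wherever the plaquettes are covered by the
domains of the table.

WHAT.
* §1 `isStarNormal_sub_one_of_mem_unitary`, ★ `norm_le_of_isStarNormal_of_eq_units_conj` (C⋆-algebra: `a` star-normal, `a = u·b·u⁻¹` ⟹ `‖a‖ ≤ ‖b‖`),
  ★ `norm_sub_one_le_of_mem_unitary_of_eq_units_conj` (`v` unitary, `v = u·w·u⁻¹` ⟹ `‖v − 1‖ ≤ ‖w − 1‖`), at `M_N(ℂ)` with the `L²`-operator norm: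
  `Node00.norm_sub_one_le_of_unitary_eq_conj`.
* §2 ★★ `dist1_plaqHol_lt_of_ofBackgroundC_mem_spaceI` — `(ιU, 0) ∈ U^c_j(Y, α₀, α₁)` (`Sect2.spaceI` of record, ANY setting over `M_N(ℂ)`) ⟹
  `dist1 (U(∂p)) < α₀·η_j²` for every plaquette `p` inside `Y`; `…_mem_spaceOfRecord` (the table of record `W1.spaceOfRecord`).
* §3 ★★ `plaqBound_of_forall_mem_spaceOfRecord` (admissible at every `(j, Y)` + a plaquette COVER of the torus by the domains of the system with `α₀(j)·η_j² ≤ a`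
  ⟹ the box `dist1 (U(∂q)) < a` at every `q`), ★★★ `admTransport_spaceOfRecord_unit_ofRecord_orbit_of_cover` — FILE 1's knit with `hsm` DISCHARGED: displayed
  `hGc`, `hcover` (lattice geometry of the domain system: every fine plaquette lies inside some domain's site set at a level whose radius fits the chart,
  `α₀(j)·η_j² ≤ a`, `((d+2)L)²a∕4 < δ_N`), `hα`, `hsat`.

0 `def`, 0 `sorry`.  References: T. Bałaban, CMP **109** (1987) 249–301 [Balaban1987RG1] ((1.10)–(1.16) p.262, (1.19) p.263); CMP **98** (1985) 17–51
[Balaban1985Averaging] (Prop. 1 (51) p.26, (19) p.21).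
-/

noncomputable section

open Set
open scoped Matrix.Norms.L2Operator NNReal ENNReal

/-! ## §1 A star-normal element conjugate to `b` by a unit has norm at most `‖b‖` -/

namespace YMDAG.N18.TransportOfRecord

section CStar

variable {A : Type*} [CStarAlgebra A]

/-- `v − 1` is star-normal for `v` unitary (`v⋆` commutes with `v`). [folklore] -/
theorem isStarNormal_sub_one_of_mem_unitary {v : A} (hv : v ∈ unitary A) : IsStarNormal (v - 1) := by
  refine ⟨?_⟩
  have hc : Commute (star v) v := by
    rw [Commute, SemiconjBy, Unitary.star_mul_self_of_mem hv, Unitary.mul_star_self_of_mem hv]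
  rw [star_sub, star_one]
  exact (hc.sub_left (Commute.one_left v)).sub_right ((Commute.one_right _).sub_left (Commute.one_left _)).symm.symm

/-- ★ **In a C⋆-algebra, a STAR-NORMAL element conjugate to `b` by a unit has norm `≤ ‖b‖`**: `‖a‖ = ρ(a)` (normality), `σ(u·b·u⁻¹) = σ(b)`, `ρ(b) ≤ ‖b‖`.
[folklore] -/
theorem norm_le_of_isStarNormal_of_eq_units_conj [Nontrivial A] {a b : A} (u : Aˣ) [IsStarNormal a] (h : a = (u : A) * b * (u⁻¹ : Aˣ)) :
    ‖a‖ ≤ ‖b‖ := by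
  have h1 : (‖a‖₊ : ℝ≥0∞) = spectralRadius ℂ a := (IsStarNormal.spectralRadius_eq_nnnorm a).symm
  have h2 : spectralRadius ℂ a = spectralRadius ℂ b := by
    rw [h, spectralRadius, spectralRadius, spectrum.units_conjugate]
  have h3 : spectralRadius ℂ b ≤ ‖b‖₊ := spectrum.spectralRadius_le_nnnorm b
  have h4 : (‖a‖₊ : ℝ≥0∞) ≤ ‖b‖₊ := by rw [h1, h2]; exact h3
  exact_mod_cast h4

/-- ★ **A UNITARY conjugate to `w` by an arbitrary unit is as close to `1` as `w`**: `v = u·w·u⁻¹`, `v` unitary ⟹ `‖v − 1‖ ≤ ‖w − 1‖` (the conjugating unit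
need not be unitary). [folklore] -/
theorem norm_sub_one_le_of_mem_unitary_of_eq_units_conj [Nontrivial A] {v w : A} (hv : v ∈ unitary A) (u : Aˣ)
    (h : v = (u : A) * w * (u⁻¹ : Aˣ)) : ‖v - 1‖ ≤ ‖w - 1‖ := by
  haveI := isStarNormal_sub_one_of_mem_unitary hv
  refine norm_le_of_isStarNormal_of_eq_units_conj u ?_
  rw [h, mul_sub, sub_mul, mul_one, Units.mul_inv]

end CStar

end YMDAG.N18.TransportOfRecord

/-! ## §1b The same at `M_N(ℂ)` with the `L²`-operator norm (the tree's local `CStarAlgebra` instance idiom) -/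

namespace Literature.MathematicalPhysics.QuantumFieldTheory.Balaban1983to89.Node00

/-- At `M_N(ℂ)` (`L²`-operator norm, `N ≥ 1`): a unitary matrix conjugate to `W` by an invertible matrix is as close to `1` as `W`. [folklore] -/
theorem norm_sub_one_le_of_unitary_eq_conj {N : ℕ} [NeZero N] {V W : MatA N} (hV : V ∈ Matrix.unitaryGroup (Fin N) ℂ) (u : (MatA N)ˣ)
    (h : V = (u : MatA N) * W * (u⁻¹ : (MatA N)ˣ)) : ‖V - 1‖ ≤ ‖W - 1‖ := by
  letI : CStarAlgebra (Matrix (Fin N) (Fin N) ℂ) := {}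
  exact YMDAG.N18.TransportOfRecord.norm_sub_one_le_of_mem_unitary_of_eq_units_conj hV u h

end Literature.MathematicalPhysics.QuantumFieldTheory.Balaban1983to89.Node00

namespace YMDAG.N18.TransportOfRecord

open Literature.MathematicalPhysics.QuantumFieldTheory.Balaban1983to89
open Literature.MathematicalPhysics.QuantumFieldTheory.Balaban1983to89.T4Continuum
open Literature.MathematicalPhysics.QuantumFieldTheory.Balaban1983to89.B12RegularSpaces111
open Literature.MathematicalPhysics.QuantumFieldTheory.Balaban1983to89.B12RegularSpaces111Gauge (plaq_gaugeU)
open Literature.MathematicalPhysics.QuantumFieldTheory.Balaban1983to89.Node00 (MatA ιSU plaqInside norm_plaq_ιSU_sub_one)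
open Literature.MathematicalPhysics.QuantumFieldTheory.Balaban1983to89.Node00.Sect2 (domSys domSites CPair ofBackgroundC embedPair spaceI frameI Setting Residual)
open Literature.MathematicalPhysics.QuantumFieldTheory.Balaban1983to89.Node00.W1
open Literature.MathematicalPhysics.QuantumFieldTheory.Balaban1983to89.BlockAveraging (Small avgFun)
open Literature.MathematicalPhysics.QuantumFieldTheory.Balaban1983to89.ExpMeanLog (expMeanLogSU deltaSU)
open Summit.QuantumFields.BalabanUV.T4Continuum.B13Carriers (transportRaw)

/-! ## §2 The plaquette box of a real background read inside a space of record -/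

section Space

variable {P : Params} {N : ℕ} [NeZero N]

/-- ★★ **A REAL BACKGROUND READ INSIDE `U^c_j(Y, α₀, α₁)` HAS ITS PLAQUETTES INSIDE `Y` WITHIN `α₀·η_j²` OF `1`** — for ANY setting over `M_N(ℂ)` (any `G`,
`Gᶜ`, `𝔤ᶜ`, any residual recipe): `(ιU, 0) = (𝐔₀, 𝐉₀)^u` with (1.14) for `𝐔₀` on the frame `regionOfSet Y`, `∂(ιU)(p) = u(x)∂𝐔₀(p)u(x)⁻¹` unitary ⟹
`dist1 (U(∂p)) = ‖∂(ιU)(p) − 1‖ ≤ ‖∂𝐔₀(p) − 1‖ < α₀·ξ²`, `ξ = η_j`. [cite: Balaban1987RG1, (1.10) p.262, (1.14) p.262, (1.19) p.263] -/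
theorem dist1_plaqHol_lt_of_ofBackgroundC_mem_spaceI (Sg : Setting (MatA N) (Node00.SU N)) (Rz : Residual P (MatA N)) (M j : ℕ) (Y : Set (Site P 0))
    (α₀ α₁ : ℝ) {U : GaugeField P 0 (Node00.SU N)} (hU : ofBackgroundC (ιSU N) U ∈ spaceI Sg Rz M j Y α₀ α₁) :
    ∀ p ∈ plaqInside Y, dist1 (GaugeField.plaqHol U p) < α₀ * P.eta j ^ 2 := by
  intro p hp
  obtain ⟨Ψ, ⟨u, Φ₀, -, hsat, rfl⟩, hΨ⟩ := hU
  obtain ⟨-, -, -, -, -, -, -, hIII, -, -⟩ := hsat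
  -- the real background's bond variables are `𝐔₀^u`
  have hUeq : gaugeU u Φ₀.U = fun b => ιSU N (U b) := by
    funext b
    exact Units.ext (congrFun (congrArg Prod.fst hΨ) b)
  -- its plaquette variable is the conjugate of `∂𝐔₀(p)` by `u(p.src)`
  have hplaq : plaq (fun b => ιSU N (U b)) p = u p.src * plaq Φ₀.U p * (u p.src)⁻¹ := by
    rw [← hUeq, plaq_gaugeU]
  have hunit : ((plaq (fun b => ιSU N (U b)) p : (MatA N)ˣ) : MatA N) ∈ Matrix.unitaryGroup (Fin N) ℂ := by
    have h : plaq (fun b => ιSU N (U b)) p = ιSU N (GaugeField.plaqHol U p) := by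
      rw [plaq_eq]; simp only [GaugeField.plaqHol, map_mul, map_inv]
    rw [h, Node00.coe_ιSU]
    exact (Matrix.mem_specialUnitaryGroup_iff.1 (GaugeField.plaqHol U p).2).1
  have hle : ‖((plaq (fun b => ιSU N (U b)) p : (MatA N)ˣ) : MatA N) - 1‖ ≤ ‖((plaq Φ₀.U p : (MatA N)ˣ) : MatA N) - 1‖ :=
    Node00.norm_sub_one_le_of_unitary_eq_conj hunit (u p.src) (by rw [hplaq, Units.val_mul, Units.val_mul])
  rw [← norm_plaq_ιSU_sub_one]
  exact hle.trans_lt (hIII.plaq_lt p hp)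

/-- The same at THE TABLE OF RECORD `W1.spaceOfRecord Sg Rz α₀ α₁ j Y` (`Y` a domain of `𝐃_j`, read as its site set `domSites Y`).
[cite: Balaban1987RG1, (1.14) p.262, (1.19) p.263] -/
theorem dist1_plaqHol_lt_of_ofBackgroundC_mem_spaceOfRecord (Sg : Setting (MatA N) (Node00.SU N)) (Rz : Residual P (MatA N)) {M : ℕ} (α₀ α₁ : ℕ → ℝ)
    (j : ℕ) (Y : (domSys P M j).Dom) {U : GaugeField P 0 (Node00.SU N)}
    (hU : ofBackgroundC (ιSU N) U ∈ spaceOfRecord (M := M) Sg Rz α₀ α₁ j Y) :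
    ∀ p ∈ plaqInside (domSites P M j Y), dist1 (GaugeField.plaqHol U p) < α₀ j * P.eta j ^ 2 :=
  dist1_plaqHol_lt_of_ofBackgroundC_mem_spaceI Sg Rz M j _ (α₀ j) (α₁ j) hU

/-- ★★ **THE PLAQUETTE BOX OF AN ADMISSIBLE BACKGROUND FROM A PLAQUETTE COVER**: if `(ιU, 0)` lies in the table of record at EVERY `(j, Y)` and every fine
plaquette `q` lies inside the site set of SOME domain `Y ∈ 𝐃_j` at a level `j` with `α₀(j)·η_j² ≤ a`, then `dist1 (U(∂q)) < a` at every `q`.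
[cite: Balaban1987RG1, (1.14) p.262, p.257 (localization domains)] -/
theorem plaqBound_of_forall_mem_spaceOfRecord (Sg : Setting (MatA N) (Node00.SU N)) (Rz : Residual P (MatA N)) {M : ℕ} (α₀ α₁ : ℕ → ℝ) {a : ℝ}
    (hcover : ∀ q : Plaq P 0, ∃ (j : ℕ) (Y : (domSys P M j).Dom), q ∈ plaqInside (domSites P M j Y) ∧ α₀ j * P.eta j ^ 2 ≤ a)
    {U : GaugeField P 0 (Node00.SU N)} (hU : ∀ (j : ℕ) (Y : (domSys P M j).Dom), ofBackgroundC (ιSU N) U ∈ spaceOfRecord (M := M) Sg Rz α₀ α₁ j Y) :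
    ∀ q : Plaq P 0, dist1 (GaugeField.plaqHol U q) < a := fun q => by
  obtain ⟨j, Y, hq, hja⟩ := hcover q
  exact (dist1_plaqHol_lt_of_ofBackgroundC_mem_spaceOfRecord Sg Rz α₀ α₁ j Y (hU j Y) q hq).trans_le hja

end Space

/-! ## §3 FILE 1's knit with the guard discharged from a plaquette cover -/

section Record

variable (F : T4Family) (N M k : ℕ) [NeZero N]

/-- ★★★ **BOTH TRANSPORT CLAUSES OF N18's READING AT THE TABLE OF RECORD FROM (T3) IN ORBIT FORM, THE GUARD DISCHARGED BY A PLAQUETTE COVER**: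
`admTransport_spaceOfRecord_unit_ofRecord_orbit_of_plaqBound` (FILE 1) with its plaquette-box hypothesis PROVED from the spaces themselves (§2): displayed are
`hGc` (run B's `Gᶜ` inside run A's — `le_rfl` at a run-constant setting), `hcover` (every fine plaquette of run B's finest lattice lies inside some domain of the
system at a level `j` with `α₀(k+1)(j)·η_j² ≤ a`; with `((d+2)L)²a∕4 < δ_N` — lattice geometry + smallness of the radii of record, NOT analysis), `hα` (run A's
radii positive) and the analysis input `hsat` ((T3) in orbit form at the unit recipe — FILES `…N18CombStep*`'s consequent shape).
[cite: Balaban1987RG1, (0.21)-(0.25) pp.256-257, (1.10)-(1.16) p.262; Balaban1985Averaging, Prop. 1 (51) p.26] -/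
theorem admTransport_spaceOfRecord_unit_ofRecord_orbit_of_cover (Sg : ℕ → Setting (MatA N) (Node00.SU N)) (α₀ α₁ : ℕ → ℕ → ℝ)
    (hGc : (Sg (k + 1)).𝓜.Gc ≤ (Sg k).𝓜.Gc) {a : ℝ} (ha : 0 ≤ a)
    (haδ : (((((F.P (k + 1)).d + 2) * (F.P (k + 1)).L : ℕ) : ℝ) ^ 2 / 4) * a < deltaSU (Fin N))
    (hcover : ∀ q : Plaq (F.P (k + 1)) 0, ∃ (j : ℕ) (Y : (domSys (F.P (k + 1)) M j).Dom),
      q ∈ plaqInside (domSites (F.P (k + 1)) M j Y) ∧ α₀ (k + 1) j * (F.P (k + 1)).eta j ^ 2 ≤ a)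
    (hα : ∀ j, 0 < α₀ k j)
    (hsat : ∀ (j : ℕ) (Y : (domSys (F.P k) M j).Dom) (Φ : FieldPair (F.P (k + 1)) 0 (MatA N)ˣ (MatA N)),
      SatisfiesI_III (Sg (k + 1)).𝓜 (frameI (Residual.unit (F.P (k + 1)) (MatA N)) M (j + 1) (domSites (F.P (k + 1)) M (j + 1) (pairOfRecord F M k ⟨j, Y⟩).2))
          (StepConsts.ofParams (F.P (k + 1)) (Sg (k + 1)).cB (j + 1)) (α₀ (k + 1) (j + 1)) (α₁ (k + 1) (j + 1)) (α₀ (k + 1) (j + 1)) Φ →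
        ∃ w : Site (F.P k) 0 → (MatA N)ˣ, (∀ x, w x ∈ (Sg k).𝓜.Gc) ∧
          SatisfiesI_III (Sg k).𝓜 (frameI (Residual.unit (F.P k) (MatA N)) M j (domSites (F.P k) M j Y)) (StepConsts.ofParams (F.P k) (Sg k).cB j) (α₀ k j)
            (α₁ k j) (α₀ k j) (act w (TΦOfRecord F N k Φ))) :
    (∀ (X : Node00.W1.Dom (F.P k) M) (ψ : CPair (F.P (k + 1)) (MatA N)),
        ψ ∈ spaceOfRecord (M := M) (Sg (k + 1)) (Residual.unit (F.P (k + 1)) (MatA N)) (α₀ (k + 1)) (α₁ (k + 1)) (pairOfRecord F M k X).1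
            (pairOfRecord F M k X).2 →
          TcfgOfRecord F N k ψ ∈ spaceOfRecord (M := M) (Sg k) (Residual.unit (F.P k) (MatA N)) (α₀ k) (α₁ k) X.1 X.2) ∧
      ∀ U : GaugeField (F.P (k + 1)) 0 (Node00.SU N),
        (∀ (j : ℕ) (Y : (domSys (F.P (k + 1)) M j).Dom),
            ofBackgroundC (ιSU N) U ∈ spaceOfRecord (M := M) (Sg (k + 1)) (Residual.unit (F.P (k + 1)) (MatA N)) (α₀ (k + 1)) (α₁ (k + 1)) j Y) →
          ∀ (j : ℕ) (Y : (domSys (F.P k) M j).Dom),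
            ofBackgroundC (ιSU N) (transportRaw F k (Node00.avOfRecord F N (k + 1) 0) U) ∈
              spaceOfRecord (M := M) (Sg k) (Residual.unit (F.P k) (MatA N)) (α₀ k) (α₁ k) j Y :=
  admTransport_spaceOfRecord_unit_ofRecord_orbit_of_plaqBound F N M k Sg α₀ α₁ hGc ha haδ
    (fun _ hU => plaqBound_of_forall_mem_spaceOfRecord (Sg (k + 1)) _ (α₀ (k + 1)) (α₁ (k + 1)) hcover hU) hα hsat

end Record

end YMDAG.N18.TransportOfRecord

end
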